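import Summits.BirchSwinnertonDyer.BirchSwinnertonDyer.Theorems.ManinLocalTwoThreeTameUnitTwistFourier

/-!
# Finite Fourier inversion on `(ℤ/m)ˣ/±1` modulo a prime `p` — the EVEN span lemma (MEMO-an §71.3)

Summit `BirchSwinnertonDyer`, route `ManinLocalTwoThree` (cell bsd-f2-manin), cruxes C3 `ManinPrimeToThreeAtNine`
(stmt-BirchSwinnertonDyer-22968) / C2 `ManinOddAtFour` (stmt-…-22967).  The sibling file
`…TameUnitTwistFourier` (p3, E-es-87♭) proves the mod-`p` span lemmas on `(ℤ/m)ˣ` under `p ∤ φ(m)` — unusable at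
`p = 2` and at prime-power moduli `m = qⁿ` for `p ∣ q - 1`.  The analytic lens's FOURIER DESCENT (MEMO-an §71.3) works
on the quotient `A = (ℤ/m)ˣ/±1`, whose order `φ(m)/2` is odd for `m = qⁿ`, `q ≡ 3 (mod 4)`: for an EVEN function `F`
(`F(-a) = F(a)`) only EVEN characters matter, the transform `F̂(χ) = Σ_a χ(a) F(a)` of an even character is twice the
sum over `A`, and Fourier inversion over `A` carries the factor `φ(m)/2` instead of `φ(m)`.

* `DirichletCharacter.sum_even_inv_mul_charSum_eq` — `Σ_{χ even} χ(b⁻¹) F̂(χ) = φ(m)·F(b)` for even `F`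
  (written as a sum over all `χ` with the indicator of `χ.Even`).
* `Int.dvd_sub_of_forall_even_isIntegral_charSum_div_of_apply_ne_one` — **the relative EVEN span lemma**: `m > 2`,
  `p` prime with `p ∤ φ(m)/2`, `F : ℤ/m → ℤ` even, `h` a unit; if for every EVEN `χ` with `χ(h) ≠ 1` some `s` prime to `p`
  makes `s·F̂(χ)/(2p)` an algebraic integer, then `p ∣ F(h·b) − F(b)` for every unit `b`.  Applied (companion files) with
  `m = qⁿ`, `h ∈ ker((ℤ/qⁿ)ˣ → (ℤ/q^{n-1})ˣ)`, where «`χ(h) ≠ 1`» forces `χ` PRIMITIVE — the descent from the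
  unipotent tower-generation law E-an-137 to the tower unit-twist law E-an-135.

HONEST FRAMING: elementary algebra (orthogonality of characters, `ℤ` integrally closed); nothing about modular forms,
Manin's conjecture or BSD is asserted or proved here.  No definitions, no named facts, no sorry.
-/

set_option linter.dupNamespace false
set_option autoImplicit false

noncomputable section

open scoped Classical

namespace Summit.BirchSwinnertonDyer.BirchSwinnertonDyer.Theorems.ManinLocalTwoThree

/-- For every Dirichlet character `χ` over `ℂ` and every `y`: `2·[χ even]·χ(y) = χ(y) + χ(-y)`. [folklore] -/
theorem DirichletCharacter.two_mul_ite_even_eq {m : ℕ} (χ : DirichletCharacter ℂ m) (y : ZMod m) :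
    2 * (if χ.Even then χ y else 0) = χ y + χ (-y) := by
  rcases χ.even_or_odd with h | h
  · rw [if_pos h, h.eval_neg, two_mul]
  · rw [if_neg h.not_even, h.eval_neg, mul_zero, add_neg_cancel]

/-- **Fourier inversion over `(ℤ/m)ˣ/±1`**: for an EVEN `F` and a unit `b`,
`Σ_{χ even} χ(b⁻¹) · F̂(χ) = φ(m) · F(b)` (`F̂(χ) = Σ_a χ(a) F(a)`; the odd characters see nothing of an even `F`).
[folklore] -/
theorem DirichletCharacter.sum_even_inv_mul_charSum_eq {m : ℕ} [NeZero m] (F : ZMod m → ℂ)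
    (hF : ∀ a, F (-a) = F a) {b : ZMod m} (hb : IsUnit b) :
    ∑ χ : DirichletCharacter ℂ m, (if χ.Even then χ b⁻¹ else 0) * ∑ a : ZMod m, χ a * F a
      = (m.totient : ℂ) * F b := by
  have hb' : IsUnit (-b) := hb.neg
  have hneg : (-b)⁻¹ = -b⁻¹ := by
    obtain ⟨v, rfl⟩ := hb
    rw [← Units.val_neg, ZMod.inv_coe_unit, ZMod.inv_coe_unit, inv_neg, Units.val_neg]
  have h1 := DirichletCharacter.sum_inv_mul_charSum_eq F hb
  have h2 := DirichletCharacter.sum_inv_mul_charSum_eq F hb'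
  rw [hF, hneg] at h2
  have hsum : 2 * ∑ χ : DirichletCharacter ℂ m, (if χ.Even then χ b⁻¹ else 0) * ∑ a : ZMod m, χ a * F a
      = (∑ χ : DirichletCharacter ℂ m, χ b⁻¹ * ∑ a : ZMod m, χ a * F a) +
        ∑ χ : DirichletCharacter ℂ m, χ (-b⁻¹) * ∑ a : ZMod m, χ a * F a := by
    rw [Finset.mul_sum, ← Finset.sum_add_distrib]
    refine Finset.sum_congr rfl fun χ _ ↦ ?_
    rw [← mul_assoc, DirichletCharacter.two_mul_ite_even_eq, add_mul]
  rw [h1, h2, ← two_mul] at hsum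
  exact mul_left_cancel₀ two_ne_zero hsum

/-- **The relative EVEN mod-`p` span lemma** (Fourier descent on `(ℤ/m)ˣ/±1`, MEMO-an §71.3).  Let `m > 2`, `p` a prime
with `p ∤ φ(m)/2`, `F : ℤ/m → ℤ` even and `h` a unit of `ℤ/m`.  If for every EVEN Dirichlet character `χ` mod `m` with
`χ(h) ≠ 1` there is `s ∈ ℕ`, `p ∤ s`, such that `s · F̂(χ) / (2p)` is an algebraic integer, then `p ∣ F(h·b) − F(b)` for
every unit `b`.  Proof: clear the multipliers (`S = ∏ s_χ`), invert over `(ℤ/m)ˣ/±1`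
(`sum_even_inv_mul_charSum_eq`): `φ(m)(F(hb) − F(b)) = Σ_{χ even} (χ((hb)⁻¹) − χ(b⁻¹)) F̂(χ)`, where the even characters with
`χ(h) = 1` drop out; so `S·φ(m)·(F(hb) − F(b))/(2p)` is a rational algebraic integer and `p ∣ S·(φ(m)/2)·(F(hb) − F(b))`.
[folklore] -/
theorem Int.dvd_sub_of_forall_even_isIntegral_charSum_div_of_apply_ne_one {m : ℕ} [NeZero m] (hm : 2 < m)
    {p : ℕ} (hp : p.Prime) (hpm : ¬ p ∣ m.totient / 2) (F : ZMod m → ℤ) (hF : ∀ a, F (-a) = F a)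
    {h : ZMod m} (hh : IsUnit h)
    (hH : ∀ χ : DirichletCharacter ℂ m, χ.Even → χ h ≠ 1 →
      ∃ s : ℕ, ¬ p ∣ s ∧ IsIntegral ℤ ((s : ℂ) * (∑ a : ZMod m, χ a * (F a : ℂ)) / (2 * p)))
    {b : ZMod m} (hb : IsUnit b) : (p : ℤ) ∣ F (h * b) - F b := by
  -- one multiplier for all characters
  have h1 : ∀ χ : DirichletCharacter ℂ m, ∃ s : ℕ, ¬ p ∣ s ∧
      (χ.Even → χ h ≠ 1 → IsIntegral ℤ ((s : ℂ) * (∑ a : ZMod m, χ a * (F a : ℂ)) / (2 * p))) := by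
    intro χ
    by_cases hχ : χ.Even ∧ χ h ≠ 1
    · obtain ⟨s, hs, hI⟩ := hH χ hχ.1 hχ.2
      exact ⟨s, hs, fun _ _ ↦ hI⟩
    · exact ⟨1, hp.one_lt.ne' ∘ Nat.dvd_one.mp, fun he hne ↦ (hχ ⟨he, hne⟩).elim⟩
  choose s hs hI using h1
  set S : ℕ := ∏ χ : DirichletCharacter ℂ m, s χ with hS
  have hpS : ¬ p ∣ S := by
    rw [hS, Prime.dvd_finsetProd_iff hp.prime]
    rintro ⟨χ, -, hχ⟩
    exact hs χ hχ
  have hSI : ∀ χ : DirichletCharacter ℂ m, χ.Even → χ h ≠ 1 →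
      IsIntegral ℤ ((S : ℂ) * (∑ a : ZMod m, χ a * (F a : ℂ)) / (2 * p)) := by
    intro χ he hne
    have e : ((S : ℂ) * (∑ a : ZMod m, χ a * (F a : ℂ)) / (2 * p)) =
        ((∏ ψ ∈ (Finset.univ.erase χ), s ψ : ℕ) : ℂ) *
          ((s χ : ℂ) * (∑ a : ZMod m, χ a * (F a : ℂ)) / (2 * p)) := by
      rw [hS, ← Finset.mul_prod_erase Finset.univ s (Finset.mem_univ χ)]
      push_cast
      ring
    rw [e]
    have hnat : ∀ K : ℕ, IsIntegral ℤ ((K : ℕ) : ℂ) := fun K ↦ by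
      simpa using isIntegral_algebraMap (R := ℤ) (A := ℂ) (x := (K : ℤ))
    exact IsIntegral.mul (hnat _) (hI χ he hne)
  -- units
  obtain ⟨u, rfl⟩ := hh
  obtain ⟨v, rfl⟩ := hb
  have huv : IsUnit ((u : ZMod m) * (v : ZMod m)) := by rw [← Units.val_mul]; exact Units.isUnit _
  have hFC : ∀ a : ZMod m, ((F (-a) : ℤ) : ℂ) = (F a : ℂ) := fun a ↦ by rw [hF]
  -- Fourier inversion over `(ℤ/m)ˣ/±1` at `h b` and at `b`
  have hFhb := DirichletCharacter.sum_even_inv_mul_charSum_eq (fun a ↦ (F a : ℂ)) hFC huv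
  have hFb := DirichletCharacter.sum_even_inv_mul_charSum_eq (fun a ↦ (F a : ℂ)) hFC (Units.isUnit v)
  -- characters trivial on `h` drop out
  have hdrop : ∀ χ : DirichletCharacter ℂ m, χ (u : ZMod m) = 1 →
      χ ((u : ZMod m) * (v : ZMod m))⁻¹ = χ (v : ZMod m)⁻¹ := by
    intro χ hχ
    have hinv : χ ((u⁻¹ : (ZMod m)ˣ) : ZMod m) = 1 := by
      have := map_mul χ ((u⁻¹ : (ZMod m)ˣ) : ZMod m) (u : ZMod m)
      rw [← Units.val_mul, inv_mul_cancel, Units.val_one, map_one, hχ, mul_one] at this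
      exact this.symm
    rw [← Units.val_mul, ZMod.inv_coe_unit, ZMod.inv_coe_unit, mul_inv_rev, Units.val_mul, map_mul, hinv, mul_one]
  -- the algebraic integer `α = Σ_{χ even} (χ (hb)⁻¹ − χ b⁻¹) · (S F̂ χ / (2p))`
  set α : ℂ := ∑ χ : DirichletCharacter ℂ m,
    ((if χ.Even then χ ((u : ZMod m) * (v : ZMod m))⁻¹ else 0) - (if χ.Even then χ (v : ZMod m)⁻¹ else 0)) *
      ((S : ℂ) * (∑ a : ZMod m, χ a * (F a : ℂ)) / (2 * p))
    with hα
  have hαI : IsIntegral ℤ α := by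
    refine IsIntegral.sum _ fun χ _ ↦ ?_
    by_cases he : χ.Even
    · rw [if_pos he, if_pos he]
      by_cases hχ : χ (u : ZMod m) = 1
      · rw [hdrop χ hχ, sub_self, zero_mul]
        exact isIntegral_zero
      · exact IsIntegral.mul ((DirichletCharacter.isIntegral_apply χ _).sub
          (DirichletCharacter.isIntegral_apply χ _)) (hSI χ he hχ)
    · rw [if_neg he, if_neg he, sub_self, zero_mul]
      exact isIntegral_zero
  -- `S · φ(m) · (F (h b) − F b) = 2p · α`
  have hp0 : (p : ℂ) ≠ 0 := by exact_mod_cast hp.ne_zero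
  have key : (((S : ℤ) * (m.totient : ℤ) * (F ((u : ZMod m) * (v : ZMod m)) - F (v : ZMod m)) : ℤ) : ℂ) /
      ((2 * p : ℕ) : ℤ) = α := by
    have e1 : α = (S : ℂ) / (2 * p) *
        (∑ χ : DirichletCharacter ℂ m, (if χ.Even then χ ((u : ZMod m) * (v : ZMod m))⁻¹ else 0) *
          ∑ a : ZMod m, χ a * (F a : ℂ)) -
        (S : ℂ) / (2 * p) *
        (∑ χ : DirichletCharacter ℂ m, (if χ.Even then χ (v : ZMod m)⁻¹ else 0) *
          ∑ a : ZMod m, χ a * (F a : ℂ)) := by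
      rw [hα, Finset.mul_sum, Finset.mul_sum, ← Finset.sum_sub_distrib]
      refine Finset.sum_congr rfl fun χ _ ↦ ?_
      field_simp
    rw [e1, hFhb, hFb]
    push_cast
    field_simp
  have hdvd : ((2 * p : ℕ) : ℤ) ∣ (S : ℤ) * (m.totient : ℤ) * (F ((u : ZMod m) * (v : ZMod m)) - F (v : ZMod m)) :=
    Int.dvd_of_isIntegral_intCast_div (by exact_mod_cast (Nat.mul_ne_zero two_ne_zero hp.ne_zero)) (key ▸ hαI)
  -- `φ(m)` is even: remove the factor `2`, then the prime-to-`p` factors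
  have heven : m.totient = 2 * (m.totient / 2) :=
    (Nat.mul_div_cancel' (even_iff_two_dvd.mp (Nat.totient_even hm))).symm
  have hdvd' : (p : ℤ) ∣ (S : ℤ) * ((m.totient / 2 : ℕ) : ℤ) * (F ((u : ZMod m) * (v : ZMod m)) - F (v : ZMod m)) := by
    have h2 : (S : ℤ) * (m.totient : ℤ) * (F ((u : ZMod m) * (v : ZMod m)) - F (v : ZMod m)) =
        2 * ((S : ℤ) * ((m.totient / 2 : ℕ) : ℤ) * (F ((u : ZMod m) * (v : ZMod m)) - F (v : ZMod m))) := by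
      conv_lhs => rw [heven]
      push_cast
      ring
    rw [h2] at hdvd
    push_cast at hdvd
    exact (mul_dvd_mul_iff_left (two_ne_zero' ℤ)).mp hdvd
  have hpZ : Prime (p : ℤ) := Nat.prime_iff_prime_int.mp hp
  rcases hpZ.dvd_or_dvd hdvd' with h1 | h1
  · rcases hpZ.dvd_or_dvd h1 with h2 | h2
    · exact absurd (Int.natCast_dvd_natCast.mp h2) hpS
    · exact absurd (Int.natCast_dvd_natCast.mp h2) hpm
  · exact h1

end Summit.BirchSwinnertonDyer.BirchSwinnertonDyer.Theorems.ManinLocalTwoThree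

end
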